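import Summits.HodgeConjecture.CorCM.ProductEigenbasis
import Summits.HodgeConjecture.CorCM.RationalExteriorAlgebra
import Literature.AlgebraicGeometry.Motives.AbelianVarietyProduct
import Literature.AlgebraicGeometry.HodgeTheory.AbelianVarietyEndomorphismsHOne
import HarnessLib

/-!
# COR-CM model layer, row M22 input R2 (part B, products): actions by endomorphisms on a binary product of
# abelian varieties — the diagonal endomorphisms, an eigenbasis of `H¹`, and the rational action

Cell `pub-hodgecm2` (COR-CM = Hodge ladder stage 2), binder row M22 `Fact_algDuality`, input **R2** on the corner
PRODUCT `P = A₀ × A₁ × A₂ × A₃` (left-nested binary products `AbelianVariety.prod`, whose underlying scheme is the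
model's `PicardCM.Var.scheme` of `prod4` definitionally), seat b26.  HONEST FRAMING: standard facts about Betti
cohomology of products; nothing about algebraic cycles and no case of the Hodge conjecture.

For ONE binary product `A₁ × A₂` of complex abelian varieties carrying maps `uᵢ : 𝓞_K → End(Aᵢ)` (any number field
`K`) this file provides, on the tree's carriers (`complexBetti`, `bettiCohomology`, `BettiUniverse.pull`,
`AbelianVariety.fst/snd/prodLift`):

* `complexKunneth_one_bijective` — Künneth in degree one with COMPLEX coefficients: `(x, y) ↦ fst^* x + snd^* y`
  is a bijection `H¹(Y(ℂ); ℂ) × H¹(Z(ℂ); ℂ) → H¹((Y ⊗ Z)(ℂ); ℂ)` for smooth projective `Y, Z` (injective by the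
  continuous sections of the projections, `exists_section_fst/snd`; surjective by the dimension count against the
  rational Künneth theorem `kunneth_one_bijective` of `CorCM/KunnethDegreeOne`);
* `exists_eigenbasis_prod` — if `uᵢ(a)^*` is diagonal on a basis `bᵢ` of `H¹(Aᵢ(ℂ); ℂ)` with eigencharacters
  `τᵢ : ιᵢ → Hom(K, ℂ)`, then the DIAGONAL endomorphisms `u(a) = (fst ≫ u₁ a, snd ≫ u₂ a)` of `A₁ × A₂` are
  diagonal on the basis `fst^* b₁ ⊔ snd^* b₂` of `H¹((A₁ × A₂)(ℂ); ℂ)` with eigencharacters `τ₁ ⊔ τ₂` — the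
  hypothesis shape of `ComplexMultiplication.exists_rosati_ratClass_of_eigenbasis` (Shimura 1998 §6.2 Thm. 4);
* `exists_ratAction_prod` — if `uᵢ(b)^* = ιᵢ(b)` on RATIONAL `H¹` for `ℚ`-algebra actions `ιᵢ : K → End_ℚ
  H¹(Aᵢ(ℂ); ℚ)`, there is a `ℚ`-algebra action `ι` of `K` on `H¹((A₁ × A₂)(ℂ); ℚ)` (conjugate of `ι₁ × ι₂` by the
  rational Künneth isomorphism) with `u(b)^* = ι(b)` and `ι(a) ∘ fst^* = fst^* ∘ ι₁(a)`, `ι(a) ∘ snd^* = snd^* ∘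
  ι₂(a)`; and `linearMap_eq_of_comp_pull_fst_snd` — a linear map out of `H¹((Y ⊗ Z)(ℂ); ℚ)` is determined by its
  composites with `fst^*` and `snd^*` (the uniqueness behind the `IsDiagAct` junction of the model).

Iterated three times these give the corner product (file `CorCM/Model/RosatiThetaProduct`).

## References
* [HatcherAT2002] A. Hatcher, *Algebraic Topology* (2002), §3.2 Thm. 3.15 (Künneth), §3.1 p. 199.
* [LangeBirkenhake1992] H. Lange, Ch. Birkenhake, *Complex Abelian Varieties* (1992), §1.1 (rational
  representation), §5.1.
* [Shimura1998] G. Shimura, *Abelian Varieties with Complex Multiplication and Modular Functions* (1998), §6.2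
  Thm. 4.
-/

noncomputable section

open CategoryTheory MonoidalCategory CartesianMonoidalCategory
open Literature.AlgebraicTopology.SingularHomology
open Literature.AlgebraicGeometry Literature.AlgebraicGeometry.Motives Literature.AlgebraicGeometry.HodgeTheory
open NumberField

namespace Summit.HodgeConjecture.CorCM.Model

/-! ### §1 Künneth in degree one with complex coefficients -/

section ComplexKunneth

variable {m n : ℕ} {Y Z : SchemeOver ℂ}

/-- **Künneth in degree one over `ℂ`, injectivity half**: `fst^* x + snd^* y = 0` in `H¹((Y ⊗ Z)(ℂ); ℂ)` forces
`x = 0` and `y = 0` (pull back along the sections `y ↦ (y, z₀)`, `z ↦ (y₀, z)`; a constant map kills `H¹`).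
[cite: HatcherAT2002, §3.2 Thm. 3.15 and §3.1 p. 199] -/
theorem complexBetti_map_fst_add_map_snd_injective (hY : IsSmoothProjective m Y) (hZ : IsSmoothProjective n Z) :
    Function.Injective ((complexBetti.map (fst Y Z) 1).hom.coprod (complexBetti.map (snd Y Z) 1).hom) := by
  haveI := pathConnectedSpace_complexPoints hY
  haveI := pathConnectedSpace_complexPoints hZ
  obtain ⟨y₀⟩ := (inferInstance : Nonempty (ComplexPoints Y))
  obtain ⟨z₀⟩ := (inferInstance : Nonempty (ComplexPoints Z))
  obtain ⟨sY, hsY₁, hsY₂⟩ := exists_section_fst Y Z z₀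
  obtain ⟨sZ, hsZ₁, hsZ₂⟩ := exists_section_snd Y Z y₀
  rw [← LinearMap.ker_eq_bot, Submodule.eq_bot_iff]
  rintro ⟨a, b⟩ hab
  rw [LinearMap.mem_ker, LinearMap.coprod_apply] at hab
  have ha : a = 0 := by
    have h := congrArg (singularCohomology.map ℂ ℂ sY 1) hab
    rw [map_add, map_zero] at h
    change singularCohomology.map ℂ ℂ sY 1
        (singularCohomology.map ℂ ℂ (AlgPoints.mapContinuous (L := ℂ) (fst Y Z)) 1 a) +
      singularCohomology.map ℂ ℂ sY 1
        (singularCohomology.map ℂ ℂ (AlgPoints.mapContinuous (L := ℂ) (snd Y Z)) 1 b) = 0 at h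
    rw [← CategoryTheory.comp_apply, ← singularCohomology.map_comp, hsY₁,
      ← CategoryTheory.comp_apply, ← singularCohomology.map_comp, hsY₂,
      singularCohomology.map_id, CategoryTheory.id_apply,
      singularCohomology.map_const_of_ne_zero ℂ z₀ one_ne_zero, add_zero] at h
    exact h
  have hb : b = 0 := by
    have h := congrArg (singularCohomology.map ℂ ℂ sZ 1) hab
    rw [map_add, map_zero] at h
    change singularCohomology.map ℂ ℂ sZ 1
        (singularCohomology.map ℂ ℂ (AlgPoints.mapContinuous (L := ℂ) (fst Y Z)) 1 a) +
      singularCohomology.map ℂ ℂ sZ 1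
        (singularCohomology.map ℂ ℂ (AlgPoints.mapContinuous (L := ℂ) (snd Y Z)) 1 b) = 0 at h
    rw [← CategoryTheory.comp_apply, ← singularCohomology.map_comp, hsZ₂,
      ← CategoryTheory.comp_apply, ← singularCohomology.map_comp, hsZ₁,
      singularCohomology.map_id, CategoryTheory.id_apply,
      singularCohomology.map_const_of_ne_zero ℂ y₀ one_ne_zero, zero_add] at h
    exact h
  rw [ha, hb]
  rfl

/-- `Hᵏ(X(ℂ); ℂ)` is finite-dimensional for `X` smooth projective (compact manifold; local copy of the tree's
`finite_complexBetti` to keep the import cone small). [cite: HatcherAT2002, App. A Cor. A.8–A.9] -/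
theorem complexBetti_finite_of_isSmoothProjective {X : SchemeOver ℂ} (hX : IsSmoothProjective n X) (k : ℕ) :
    Module.Finite ℂ (complexBetti X k) := by
  letI := hX.chartedSpace
  haveI := ComplexPoints.compactSpace_of_isSmoothProjective hX
  haveI := ComplexPoints.t2Space_of_isSmoothProjective hX
  exact finite_singularCohomology_of_compact_chartedSpace ℂ ℂ (d := 2 * n) k

/-- **Künneth in degree one over `ℂ`**: `(x, y) ↦ fst^* x + snd^* y` is a bijection
`H¹(Y(ℂ); ℂ) × H¹(Z(ℂ); ℂ) → H¹((Y ⊗ Z)(ℂ); ℂ)` for smooth projective `Y, Z` (injective by the sections;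
dimensions agree by the rational Künneth theorem and universal coefficients).
[cite: HatcherAT2002, §3.2 Thm. 3.15] -/
theorem complexKunneth_one_bijective (hY : IsSmoothProjective m Y) (hZ : IsSmoothProjective n Z) :
    Function.Bijective ((complexBetti.map (fst Y Z) 1).hom.coprod (complexBetti.map (snd Y Z) 1).hom) := by
  haveI := complexBetti_finite_of_isSmoothProjective hY 1
  haveI := complexBetti_finite_of_isSmoothProjective hZ 1
  haveI := complexBetti_finite_of_isSmoothProjective (IsSmoothProjective.tensor_holds hY hZ) 1
  refine ⟨complexBetti_map_fst_add_map_snd_injective hY hZ,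
    (LinearMap.injective_iff_surjective_of_finrank_eq_finrank ?_).1
      (complexBetti_map_fst_add_map_snd_injective hY hZ)⟩
  rw [Module.finrank_prod, ← finrank_bettiCohomology_eq_finrank_complexBetti,
    ← finrank_bettiCohomology_eq_finrank_complexBetti, ← finrank_bettiCohomology_eq_finrank_complexBetti,
    finrank_bettiCohomology_one_tensor hY hZ]

end ComplexKunneth

/-! ### §2 The diagonal endomorphisms of a binary product and an eigenbasis of its `H¹` -/

section Eigenbasis

variable {K : Type*} [Field K] [NumberField K]
variable {A₁ A₂ : AbelianVariety ℂ}

/-- On underlying schemes the diagonal endomorphism `(fst ≫ f₁, snd ≫ f₂)` of `A₁ × A₂` commutes with the first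
projection: `(f₁, f₂) ≫ fst = fst ≫ f₁`. [folklore] -/
theorem prodLift_diag_fst (f₁ : A₁ ⟶ A₁) (f₂ : A₂ ⟶ A₂) :
    (AbelianVariety.prodLift (AbelianVariety.fst A₁ A₂ ≫ f₁) (AbelianVariety.snd A₁ A₂ ≫ f₂)).hom.hom.hom ≫
        (AbelianVariety.fst A₁ A₂).hom.hom.hom =
      (AbelianVariety.fst A₁ A₂).hom.hom.hom ≫ f₁.hom.hom.hom := by
  change (AbelianVariety.prodLift (AbelianVariety.fst A₁ A₂ ≫ f₁) (AbelianVariety.snd A₁ A₂ ≫ f₂) ≫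
      AbelianVariety.fst A₁ A₂).hom.hom.hom = (AbelianVariety.fst A₁ A₂ ≫ f₁).hom.hom.hom
  rw [AbelianVariety.prodLift_fst]

/-- On underlying schemes `(f₁, f₂) ≫ snd = snd ≫ f₂`. [folklore] -/
theorem prodLift_diag_snd (f₁ : A₁ ⟶ A₁) (f₂ : A₂ ⟶ A₂) :
    (AbelianVariety.prodLift (AbelianVariety.fst A₁ A₂ ≫ f₁) (AbelianVariety.snd A₁ A₂ ≫ f₂)).hom.hom.hom ≫
        (AbelianVariety.snd A₁ A₂).hom.hom.hom =
      (AbelianVariety.snd A₁ A₂).hom.hom.hom ≫ f₂.hom.hom.hom := by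
  change (AbelianVariety.prodLift (AbelianVariety.fst A₁ A₂ ≫ f₁) (AbelianVariety.snd A₁ A₂ ≫ f₂) ≫
      AbelianVariety.snd A₁ A₂).hom.hom.hom = (AbelianVariety.snd A₁ A₂ ≫ f₂).hom.hom.hom
  rw [AbelianVariety.prodLift_snd]

/-- `(f₁, f₂)^* (fst^* x) = fst^* (f₁^* x)` on `Hᵏ(–(ℂ); ℂ)`. [cite: HatcherAT2002, §3.1 p. 199] -/
theorem complexBetti_map_diag_fst (f₁ : A₁ ⟶ A₁) (f₂ : A₂ ⟶ A₂) (k : ℕ) (x : complexBetti A₁.X k) :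
    complexBetti.map (AbelianVariety.prodLift (AbelianVariety.fst A₁ A₂ ≫ f₁)
        (AbelianVariety.snd A₁ A₂ ≫ f₂)).hom.hom.hom k
        (complexBetti.map (AbelianVariety.fst A₁ A₂).hom.hom.hom k x) =
      complexBetti.map (AbelianVariety.fst A₁ A₂).hom.hom.hom k (complexBetti.map f₁.hom.hom.hom k x) := by
  rw [← CategoryTheory.comp_apply, ← complexBetti.map_comp, prodLift_diag_fst, complexBetti.map_comp,
    CategoryTheory.comp_apply]

/-- `(f₁, f₂)^* (snd^* y) = snd^* (f₂^* y)` on `Hᵏ(–(ℂ); ℂ)`. [cite: HatcherAT2002, §3.1 p. 199] -/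
theorem complexBetti_map_diag_snd (f₁ : A₁ ⟶ A₁) (f₂ : A₂ ⟶ A₂) (k : ℕ) (y : complexBetti A₂.X k) :
    complexBetti.map (AbelianVariety.prodLift (AbelianVariety.fst A₁ A₂ ≫ f₁)
        (AbelianVariety.snd A₁ A₂ ≫ f₂)).hom.hom.hom k
        (complexBetti.map (AbelianVariety.snd A₁ A₂).hom.hom.hom k y) =
      complexBetti.map (AbelianVariety.snd A₁ A₂).hom.hom.hom k (complexBetti.map f₂.hom.hom.hom k y) := by
  rw [← CategoryTheory.comp_apply, ← complexBetti.map_comp, prodLift_diag_snd, complexBetti.map_comp,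
    CategoryTheory.comp_apply]

omit [NumberField K] in
/-- **An eigenbasis of `H¹` of a binary product for the diagonal endomorphisms.**  If `u₁(a)^*`, `u₂(a)^*` are
diagonal on bases `b₁`, `b₂` of `H¹(A₁(ℂ); ℂ)`, `H¹(A₂(ℂ); ℂ)` with eigencharacters `τ₁`, `τ₂`, then the diagonal
endomorphisms `(fst ≫ u₁ a, snd ≫ u₂ a)` of `A₁ × A₂` are diagonal on the basis `fst^* b₁ ⊔ snd^* b₂` of
`H¹((A₁ × A₂)(ℂ); ℂ)` (complex Künneth in degree one) with eigencharacters `τ₁ ⊔ τ₂`.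
[cite: Shimura1998, §6.2 Thm. 4] [cite: HatcherAT2002, §3.2 Thm. 3.15] -/
theorem exists_eigenbasis_prod {ι₁ ι₂ : Type*} (u₁ : 𝓞 K → (A₁ ⟶ A₁)) (u₂ : 𝓞 K → (A₂ ⟶ A₂))
    (b₁ : Module.Basis ι₁ ℂ (complexBetti A₁.X 1)) (b₂ : Module.Basis ι₂ ℂ (complexBetti A₂.X 1))
    (τ₁ : ι₁ → (K →+* ℂ)) (τ₂ : ι₂ → (K →+* ℂ))
    (hb₁ : ∀ (a : 𝓞 K) (i : ι₁), complexBetti.map (u₁ a).hom.hom.hom 1 (b₁ i) = (τ₁ i (a : K)) • b₁ i)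
    (hb₂ : ∀ (a : 𝓞 K) (i : ι₂), complexBetti.map (u₂ a).hom.hom.hom 1 (b₂ i) = (τ₂ i (a : K)) • b₂ i) :
    ∃ b : Module.Basis (ι₁ ⊕ ι₂) ℂ (complexBetti (A₁.prod A₂).X 1),
      (∀ i, b (Sum.inl i) = complexBetti.map (AbelianVariety.fst A₁ A₂).hom.hom.hom 1 (b₁ i)) ∧
      (∀ j, b (Sum.inr j) = complexBetti.map (AbelianVariety.snd A₁ A₂).hom.hom.hom 1 (b₂ j)) ∧
      ∀ (a : 𝓞 K) (i : ι₁ ⊕ ι₂),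
        complexBetti.map (AbelianVariety.prodLift (AbelianVariety.fst A₁ A₂ ≫ u₁ a)
            (AbelianVariety.snd A₁ A₂ ≫ u₂ a)).hom.hom.hom 1 (b i) = (Sum.elim τ₁ τ₂ i (a : K)) • b i := by
  let e : (complexBetti A₁.X 1 × complexBetti A₂.X 1) ≃ₗ[ℂ] complexBetti (A₁.prod A₂).X 1 :=
    LinearEquiv.ofBijective _ (complexKunneth_one_bijective (Y := A₁.X) (Z := A₂.X)
      AbelianVariety.isSmoothProjective_holds AbelianVariety.isSmoothProjective_holds)
  have he : ∀ p, e p = complexBetti.map (AbelianVariety.fst A₁ A₂).hom.hom.hom 1 p.1 +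
      complexBetti.map (AbelianVariety.snd A₁ A₂).hom.hom.hom 1 p.2 := fun p ↦ rfl
  have hinl : ∀ i, (b₁.prod b₂).map e (Sum.inl i) =
      complexBetti.map (AbelianVariety.fst A₁ A₂).hom.hom.hom 1 (b₁ i) := fun i ↦ by
    rw [Module.Basis.map_apply, he, Module.Basis.prod_apply, Sum.elim_inl, Function.comp_apply,
      LinearMap.inl_apply, map_zero, add_zero]
  have hinr : ∀ j, (b₁.prod b₂).map e (Sum.inr j) =
      complexBetti.map (AbelianVariety.snd A₁ A₂).hom.hom.hom 1 (b₂ j) := fun j ↦ by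
    rw [Module.Basis.map_apply, he, Module.Basis.prod_apply, Sum.elim_inr, Function.comp_apply,
      LinearMap.inr_apply, map_zero, zero_add]
  refine ⟨(b₁.prod b₂).map e, hinl, hinr, fun a i ↦ ?_⟩
  cases i with
  | inl i => rw [hinl, complexBetti_map_diag_fst, hb₁, map_smul, Sum.elim_inl]
  | inr j => rw [hinr, complexBetti_map_diag_snd, hb₂, map_smul, Sum.elim_inr]

end Eigenbasis

/-! ### §3 The rational action on `H¹` of a binary product -/

section RatAction

variable {m n : ℕ} {Y Z : SchemeOver ℂ}

/-- A linear map out of `H¹((Y ⊗ Z)(ℂ); ℚ)` is determined by its composites with `fst^*` and `snd^*`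
(Künneth in degree one, spanning half). [cite: HatcherAT2002, §3.2 Thm. 3.15] -/
theorem linearMap_eq_of_comp_pull_fst_snd (hY : IsSmoothProjective m Y) (hZ : IsSmoothProjective n Z)
    {W : Type*} [AddCommGroup W] [Module ℚ W] {S T : bettiCohomology (Y ⊗ Z) 1 →ₗ[ℚ] W}
    (h₁ : S ∘ₗ BettiUniverse.pull (fst Y Z) 1 = T ∘ₗ BettiUniverse.pull (fst Y Z) 1)
    (h₂ : S ∘ₗ BettiUniverse.pull (snd Y Z) 1 = T ∘ₗ BettiUniverse.pull (snd Y Z) 1) : S = T := by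
  refine LinearMap.ext fun v ↦ ?_
  obtain ⟨⟨x, y⟩, rfl⟩ := (kunneth_one_bijective hY hZ).2 v
  rw [LinearMap.coprod_apply, map_add, map_add, ← LinearMap.comp_apply, h₁, LinearMap.comp_apply,
    ← LinearMap.comp_apply (f := S), h₂, LinearMap.comp_apply]

variable {K : Type*} [Field K] [NumberField K]
variable {A₁ A₂ : AbelianVariety ℂ}

/-- `(f₁, f₂)^* ∘ fst^* = fst^* ∘ f₁^*` on rational `Hᵏ`. [cite: HatcherAT2002, §3.1 p. 199] -/
theorem pull_diag_comp_pull_fst (f₁ : A₁ ⟶ A₁) (f₂ : A₂ ⟶ A₂) (k : ℕ) :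
    BettiUniverse.pull (AbelianVariety.prodLift (AbelianVariety.fst A₁ A₂ ≫ f₁)
        (AbelianVariety.snd A₁ A₂ ≫ f₂)).hom.hom.hom k ∘ₗ BettiUniverse.pull (AbelianVariety.fst A₁ A₂).hom.hom.hom k =
      BettiUniverse.pull (AbelianVariety.fst A₁ A₂).hom.hom.hom k ∘ₗ BettiUniverse.pull f₁.hom.hom.hom k := by
  rw [← BettiUniverse.pull_comp, ← BettiUniverse.pull_comp, prodLift_diag_fst]

/-- `(f₁, f₂)^* ∘ snd^* = snd^* ∘ f₂^*` on rational `Hᵏ`. [cite: HatcherAT2002, §3.1 p. 199] -/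
theorem pull_diag_comp_pull_snd (f₁ : A₁ ⟶ A₁) (f₂ : A₂ ⟶ A₂) (k : ℕ) :
    BettiUniverse.pull (AbelianVariety.prodLift (AbelianVariety.fst A₁ A₂ ≫ f₁)
        (AbelianVariety.snd A₁ A₂ ≫ f₂)).hom.hom.hom k ∘ₗ BettiUniverse.pull (AbelianVariety.snd A₁ A₂).hom.hom.hom k =
      BettiUniverse.pull (AbelianVariety.snd A₁ A₂).hom.hom.hom k ∘ₗ BettiUniverse.pull f₂.hom.hom.hom k := by
  rw [← BettiUniverse.pull_comp, ← BettiUniverse.pull_comp, prodLift_diag_snd]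

/-- **The rational action of `K` on `H¹` of a binary product.**  Given `ℚ`-algebra actions `ιᵢ : K → End_ℚ
H¹(Aᵢ(ℂ); ℚ)` and maps `uᵢ : 𝓞_K → End(Aᵢ)` with `uᵢ(b)^* = ιᵢ(b)` on `H¹`, there is a `ℚ`-algebra action `ι` of
`K` on `H¹((A₁ × A₂)(ℂ); ℚ)` — the conjugate of `ι₁ × ι₂` by the rational Künneth isomorphism — intertwined with
`ι₁`, `ι₂` by `fst^*`, `snd^*` and induced on `𝓞_K` by the diagonal endomorphisms: `(fst ≫ u₁ b, snd ≫ u₂ b)^* =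
ι(b)`. [cite: LangeBirkenhake1992, §1.1 (rational representation)] [cite: Shimura1998, §6.2 Thm. 4] -/
theorem exists_ratAction_prod (ι₁ : K →ₐ[ℚ] Module.End ℚ (bettiCohomology A₁.X 1))
    (ι₂ : K →ₐ[ℚ] Module.End ℚ (bettiCohomology A₂.X 1))
    (u₁ : 𝓞 K → (A₁ ⟶ A₁)) (u₂ : 𝓞 K → (A₂ ⟶ A₂))
    (hu₁ : ∀ b : 𝓞 K, BettiUniverse.pull (u₁ b).hom.hom.hom 1 = ι₁ (b : K))
    (hu₂ : ∀ b : 𝓞 K, BettiUniverse.pull (u₂ b).hom.hom.hom 1 = ι₂ (b : K)) :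
    ∃ ι : K →ₐ[ℚ] Module.End ℚ (bettiCohomology (A₁.prod A₂).X 1),
      (∀ a : K, ι a ∘ₗ BettiUniverse.pull (AbelianVariety.fst A₁ A₂).hom.hom.hom 1 =
        BettiUniverse.pull (AbelianVariety.fst A₁ A₂).hom.hom.hom 1 ∘ₗ ι₁ a) ∧
      (∀ a : K, ι a ∘ₗ BettiUniverse.pull (AbelianVariety.snd A₁ A₂).hom.hom.hom 1 =
        BettiUniverse.pull (AbelianVariety.snd A₁ A₂).hom.hom.hom 1 ∘ₗ ι₂ a) ∧
      ∀ b : 𝓞 K, BettiUniverse.pull (AbelianVariety.prodLift (AbelianVariety.fst A₁ A₂ ≫ u₁ b)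
          (AbelianVariety.snd A₁ A₂ ≫ u₂ b)).hom.hom.hom 1 = ι (b : K) := by
  have hY : IsSmoothProjective A₁.dim A₁.X := AbelianVariety.isSmoothProjective_holds
  have hZ : IsSmoothProjective A₂.dim A₂.X := AbelianVariety.isSmoothProjective_holds
  let e : (bettiCohomology A₁.X 1 × bettiCohomology A₂.X 1) ≃ₗ[ℚ] bettiCohomology (A₁.prod A₂).X 1 :=
    LinearEquiv.ofBijective _ (kunneth_one_bijective (Y := A₁.X) (Z := A₂.X) hY hZ)
  have he : ∀ p, e p = BettiUniverse.pull (AbelianVariety.fst A₁ A₂).hom.hom.hom 1 p.1 +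
      BettiUniverse.pull (AbelianVariety.snd A₁ A₂).hom.hom.hom 1 p.2 := fun p ↦ rfl
  let ι : K →ₐ[ℚ] Module.End ℚ (bettiCohomology (A₁.prod A₂).X 1) :=
    (e.conjAlgEquiv ℚ).toAlgHom.comp ((LinearMap.prodMapAlgHom ℚ _ _).comp (ι₁.prod ι₂))
  -- `ι a (e p) = e (ι₁ a p.1, ι₂ a p.2)`
  have hι : ∀ (a : K) (p : bettiCohomology A₁.X 1 × bettiCohomology A₂.X 1),
      ι a (e p) = e (ι₁ a p.1, ι₂ a p.2) := by
    intro a p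
    change (e.toLinearMap ∘ₗ ((ι₁ a).prodMap (ι₂ a)) ∘ₗ e.symm.toLinearMap) (e p) = _
    rw [LinearMap.comp_apply, LinearMap.comp_apply, LinearEquiv.coe_toLinearMap, LinearEquiv.coe_toLinearMap,
      e.symm_apply_apply, LinearMap.prodMap_apply]
  have h1 : ∀ a : K, ι a ∘ₗ BettiUniverse.pull (AbelianVariety.fst A₁ A₂).hom.hom.hom 1 =
      BettiUniverse.pull (AbelianVariety.fst A₁ A₂).hom.hom.hom 1 ∘ₗ ι₁ a := by
    intro a
    refine LinearMap.ext fun x ↦ ?_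
    have h := hι a (x, 0)
    simp only [he, map_zero, add_zero] at h
    rw [LinearMap.comp_apply, LinearMap.comp_apply]
    exact h
  have h2 : ∀ a : K, ι a ∘ₗ BettiUniverse.pull (AbelianVariety.snd A₁ A₂).hom.hom.hom 1 =
      BettiUniverse.pull (AbelianVariety.snd A₁ A₂).hom.hom.hom 1 ∘ₗ ι₂ a := by
    intro a
    refine LinearMap.ext fun y ↦ ?_
    have h := hι a (0, y)
    simp only [he, map_zero, zero_add] at h
    rw [LinearMap.comp_apply, LinearMap.comp_apply]
    exact h
  refine ⟨ι, h1, h2, fun b ↦ ?_⟩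
  refine linearMap_eq_of_comp_pull_fst_snd (Y := A₁.X) (Z := A₂.X) hY hZ ?_ ?_
  · change _ ∘ₗ BettiUniverse.pull (AbelianVariety.fst A₁ A₂).hom.hom.hom 1 =
      _ ∘ₗ BettiUniverse.pull (AbelianVariety.fst A₁ A₂).hom.hom.hom 1
    rw [h1, ← hu₁]
    exact pull_diag_comp_pull_fst (u₁ b) (u₂ b) 1
  · change _ ∘ₗ BettiUniverse.pull (AbelianVariety.snd A₁ A₂).hom.hom.hom 1 =
      _ ∘ₗ BettiUniverse.pull (AbelianVariety.snd A₁ A₂).hom.hom.hom 1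
    rw [h2, ← hu₂]
    exact pull_diag_comp_pull_snd (u₁ b) (u₂ b) 1

end RatAction

end Summit.HodgeConjecture.CorCM.Model

end
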